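import Summits.Ventures.CertifiedManyBodySolver.Observables.RungLeavesStiffnessAnchor
import Summits.HubbardSuperconductivity.HubbardLadder.Bounds.HalfBathtubStiffnessBoundTL
import HarnessLib

/-!
# Ventures/CertifiedManyBodySolver — Observables/StiffnessKinematicLeafTTPrime.lean

HONEST FRAMING: one-sided CEILINGS on the uniform flux stiffness at the KINEMATIC (one-body) scale, any `t′`; a ceiling never speaks to the
presence of order; not informative vs print; not a superconductivity verdict.

Cell `hubbard-obs` (D-0042), seat p2 (stiffness), `prover-hubbard-obs-p2-g9-0`. The `t′`-GENERIC kinematic bar in the language of the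
anchor leaves (`Observables/RungLeavesStiffnessAnchor.lean`), for the `t′ ≠ 0` anchors of the burst table (A2/A10 = (·, 7/8, −¼), A3 = (8, 7/8, +¼),
A9 = (8, 4/5, −¼)), where the `t′ = 0` rational leaf `4/π²` of `Observables/StiffnessKinematicLeaf.lean` does not apply. SOURCE, BY NAME: pub-hubbard's
PROVED half-bathtub ceiling with explicit rate, `Summit.HubbardSuperconductivity.HubbardLadder.Bounds.halfBathtubStiffnessBoundTL_holds`
(bounds.tex Cor. 2.2(iii): for every side `L ≥ 3`, `ρ_s ≤ ν(1−δ)/2 + B(t′, ν) + (|ν| + 2π(1 + 4|t′|))/L`,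
`B(t′, ν) = (4π²)⁻¹ ∫_{−π}^{π}∫_{−π}^{π} (cos x + cos y + 4t′ cos x cos y − ν)⁺ dx dy`). NEW here (zero compute, no definition, no `sorry`):

* `fluxStiffness_le_halfBathtub_seq` — the `L → ∞` form pub-hubbard deliberately left out, in the SEQUENCE-ROBUST shape: for every sequence of sides
  `L_j → ∞` and every `ρ_s > 0` (scale `θ₀ > 0`) whose flux inequality holds at every `L_j`, `ρ_s ≤ ν·n/2 + B(t′, ν)` for EVERY `ν` (the `1/L` rate term
  is removed by `Filter.Tendsto.div_atTop`); any `t′`, any `U`, `0 ≤ n ≤ 2`;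
* `ObsStiffnessSeqCeilingAt_of_halfBathtub_le` — hence `ObsStiffnessSeqCeilingAt tp U n c` for every rational `c` with `ν·n/2 + B(t′, ν) ≤ c` for some
  `ν` (the hook for an interval-certified evaluation of `B`; the optimum over `ν` is the one-body value `s_w(n, t′)/2` of pub-hubbard EXTREMISERS §2 —
  float-evaluated for the anchor table in HOME/hubbard-obs-p2/STIFFNESS-LINE.md §3: (7/8, 0) 0.4019425, (7/8, −¼) 0.3947759, (7/8, +¼) 0.4540981,
  (4/5, 0) 0.3957697, (15/16, 0) 0.4045548, (4/5, −¼) 0.3692095 — none of these decimals is asserted here);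
* `ObsStiffnessCeilingAt_of_halfBathtub_le` — the all-even-sides form.

References: T. Hazra, N. Verma, M. Randeria, PRX 9 (2019) 031049, eqs. (2)–(6) [HazraVermaRanderia2019]; A. Paramekanti, N. Trivedi, M. Randeria,
PRB 57 (1998) 11639, eq. (3) [ParamekantiTrivediRanderia1998]; D. J. Scalapino, S. R. White, S.-C. Zhang, PRB 47 (1993) 7995, §II [ScalapinoWhiteZhang1993].
-/

noncomputable section

namespace Summit.Ventures.CertifiedManyBodySolver.Observables

open Filter Topology Real MeasureTheory
open Literature.MathematicalPhysics.QuantumLattice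
open Literature.MathematicalPhysics.QuantumLattice.ThermodynamicLimit
open Summit.HubbardSuperconductivity.HubbardLadder.Bounds

/-- **The half-bathtub (one-body) stiffness ceiling along a sequence of sides, any `t′`.** `0 ≤ n ≤ 2`, any `t′`, `U`; `Ls → ∞`; if `ρ_s > 0`
(scale `θ₀ > 0`) satisfies `ρ_s θ² ≤ E_{L_j}(θ) − E_{L_j}(0)` (`E_L = fluxEnergyTT' L t′ U (1 − n)`, `|θ| ≤ θ₀`) at every side of the sequence, then for
every `ν ∈ ℝ`: `ρ_s ≤ ν·n/2 + (4π²)⁻¹ ∫_{−π}^{π}∫_{−π}^{π} (cos x + cos y + 4t′ cos x cos y − ν)⁺ dx dy` — pub-hubbard's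
`halfBathtubStiffnessBoundTL_holds` at each side `L_j ≥ 3`, and the rate term `(|ν| + 2π(1 + 4|t′|))/L_j → 0`.
[cite: HazraVermaRanderia2019, eqs. (2)–(6)] -/
theorem fluxStiffness_le_halfBathtub_seq (tp U n : ℝ) (hn0 : 0 ≤ n) (hn2 : n ≤ 2) {ρs θ₀ : ℝ} (hρs : 0 < ρs)
    (hθ₀ : 0 < θ₀) {Ls : ℕ → ℕ} (hLs : Tendsto Ls atTop atTop)
    (hst : ∀ (j : ℕ) [NeZero (Ls j)] (θ : ℝ), |θ| ≤ θ₀ →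
      ρs * θ ^ 2 ≤ fluxEnergyTT' (Ls j) tp U (1 - n) θ - fluxEnergyTT' (Ls j) tp U (1 - n) 0) (ν : ℝ) :
    ρs ≤ ν * n / 2 +
      (∫ y in (-π)..π, ∫ x in (-π)..π,
          max (Real.cos x + Real.cos y + 4 * tp * (Real.cos x * Real.cos y) - ν) 0) / (4 * π ^ 2) := by
  -- the finite-side bound with its `1/L` rate, eventually along the sequence
  have hev : ∀ᶠ j in atTop, ρs ≤ ν * n / 2 +
      (∫ y in (-π)..π, ∫ x in (-π)..π,
          max (Real.cos x + Real.cos y + 4 * tp * (Real.cos x * Real.cos y) - ν) 0) / (4 * π ^ 2) +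
        (|ν| + 2 * π * (1 + 4 * |tp|)) / ((Ls j : ℕ) : ℝ) := by
    filter_upwards [hLs.eventually_ge_atTop 3] with j hj
    haveI : NeZero (Ls j) := ⟨by omega⟩
    have h := halfBathtubStiffnessBoundTL_holds (Ls j) hj tp U (1 - n) ρs θ₀ (by linarith) (by linarith) hρs hθ₀
      (hst j) ν
    have hνn : ν * (1 - (1 - n)) / 2 = ν * n / 2 := by ring
    rw [hνn] at h
    exact h
  -- the rate term tends to zero
  have hrate : Tendsto (fun j => (|ν| + 2 * π * (1 + 4 * |tp|)) / ((Ls j : ℕ) : ℝ)) atTop (𝓝 0) :=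
    tendsto_const_nhds.div_atTop (tendsto_natCast_atTop_atTop.comp hLs)
  have hlim : Tendsto (fun j => ν * n / 2 +
      (∫ y in (-π)..π, ∫ x in (-π)..π,
          max (Real.cos x + Real.cos y + 4 * tp * (Real.cos x * Real.cos y) - ν) 0) / (4 * π ^ 2) +
        (|ν| + 2 * π * (1 + 4 * |tp|)) / ((Ls j : ℕ) : ℝ)) atTop
      (𝓝 (ν * n / 2 +
        (∫ y in (-π)..π, ∫ x in (-π)..π,
          max (Real.cos x + Real.cos y + 4 * tp * (Real.cos x * Real.cos y) - ν) 0) / (4 * π ^ 2) + 0)) :=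
    tendsto_const_nhds.add hrate
  rw [add_zero] at hlim
  exact ge_of_tendsto hlim hev

/-- **Hook for a certified evaluation**: if some `ν` and a rational `c` satisfy `ν·n/2 + B(t′, ν) ≤ c`, then `ObsStiffnessSeqCeilingAt tp U n c`
(`0 ≤ n ≤ 2`, any `t′`, `U`; no claim node). [cite: ScalapinoWhiteZhang1993, §II] -/
theorem ObsStiffnessSeqCeilingAt_of_halfBathtub_le (tp U n : ℝ) (hn0 : 0 ≤ n) (hn2 : n ≤ 2) (ν : ℝ) (c : ℚ)
    (hc : ν * n / 2 +
      (∫ y in (-π)..π, ∫ x in (-π)..π,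
          max (Real.cos x + Real.cos y + 4 * tp * (Real.cos x * Real.cos y) - ν) 0) / (4 * π ^ 2) ≤ ((c : ℚ) : ℝ)) :
    ObsStiffnessSeqCeilingAt tp U n c :=
  fun _ρs _θ₀ hρs hθ₀ _Ls hLs hst =>
    (fluxStiffness_le_halfBathtub_seq tp U n hn0 hn2 hρs hθ₀ hLs hst ν).trans hc

/-- The all-even-sides form of the hook. [cite: ScalapinoWhiteZhang1993, §II] -/
theorem ObsStiffnessCeilingAt_of_halfBathtub_le (tp U n : ℝ) (hn0 : 0 ≤ n) (hn2 : n ≤ 2) (ν : ℝ) (c : ℚ)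
    (hc : ν * n / 2 +
      (∫ y in (-π)..π, ∫ x in (-π)..π,
          max (Real.cos x + Real.cos y + 4 * tp * (Real.cos x * Real.cos y) - ν) 0) / (4 * π ^ 2) ≤ ((c : ℚ) : ℝ)) :
    ObsStiffnessCeilingAt tp U n c :=
  (ObsStiffnessSeqCeilingAt_of_halfBathtub_le tp U n hn0 hn2 ν c hc).ceilingAt

end Summit.Ventures.CertifiedManyBodySolver.Observables

end
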